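import Literature.AlgebraicGeometry.AbelianSchemes.FrobeniusTwistOfRoof
import Literature.AlgebraicGeometry.AbelianSchemes.SerreTensorUntwist
import Literature.AlgebraicGeometry.AbelianSchemes.RoofCoverPolarizationTransport
import Literature.AlgebraicGeometry.AbelianSchemes.RoofCoverLevelTransport
import Literature.AlgebraicGeometry.AbelianSchemes.AbelianSchemeFixedPowBaseChange
import Literature.AlgebraicGeometry.AbelianSchemes.AbelianSchemeOverCommOfReduced
import Literature.AlgebraicGeometry.AbelianSchemes.SerreTensorFrobeniusTwistPolarization
import Literature.AlgebraicGeometry.AbelianSchemes.AbelianSchemePolarizationBaseChange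
import Literature.AlgebraicGeometry.AbelianSchemes.PolarizationUnitHypothesis
import Literature.AlgebraicGeometry.AbelianSchemes.PolarizationLamEtale
import Literature.AlgebraicGeometry.Motives.AbelianVarietyVerschiebung
import Literature.AlgebraicGeometry.Motives.AbelianVarietyFrobeniusKernelBlocks
import HarnessLib

/-!
# σ2 ASSEMBLY for HEART-FROB′: from the downstairs ROOF `A —q̄→ B̄ ←c̄— A″` and the Frobenius COVER `c̄′ : A′ → A^{(q)}` to an EXACT identification
# `f : A′ ≅ A″` (homomorphism, `𝒪`-equivariant, `f^*λ″ = λ′`, level points matched)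

Topic `Literature/AlgebraicGeometry/AbelianSchemes`, namespace `Literature.AlgebraicGeometry.AbelianSchemes.AbelianSchemeOver`.  THEOREMS ONLY (no definition, no
named fact, no `instance`, no notation, no `sorry`); base `Spec k`, `k = k̄` of exponential characteristic `p`.  Cell `hodgecm-mathlib` (D-0151), FLOOR 0, P6 «MOD
programme» (crux hLiu418 = stmt-HodgeConjecture-24832, `--supports`, count-neutral), σ2 (β′) hand of `stub_HFROB`, **BRICK Σ «σ2 ASSEMBLY»**: ONE abstract theorem composing
the ★ σ2 bricks — ★ `FrobeniusTwistOfRoof.exists_iso_frobeniusTwist_serreTensor_of_roof_over` (roof leg), ★ `SerreTensorRecognitionOfPoints` §3 (cover leg), ★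
`SerreTensorUntwist` (untwist), ★ `RoofCoverPolarizationTransport` (λ-leg), ★ `RoofCoverLevelTransport` (level leg) — so that the closer of
`stub_HFROB : RecordHeartFrobenius` (P6a `Lines/F0_P6a_ModuliDatum.lean` ED. 3) instantiates ONCE at the moduli datum's `Roof₀`/`FrobCover₀` fields (Defs ED. 2: (f1′)
kernel clause, (f6) `twistIdeal_coprime`) and hands `f` to the transfer brick `tupleIsoAt_of_sch₀Iso` (σ1) and `inj₀`.  INPUT (all in the token shapes of `Roof₀` ∕ `FrobCover₀`
∕ ★ (DF)): abelian `k`-schemes `A A′ A″ B̄`, the Frobenius twist `A^{(q)} := A.baseChange (frobSpec k p n)` with `F_q := relFrobeniusOver p n A.X`, `𝒪`-actions, three Serre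
presentations of `𝔭⁻¹ 𝔠⁻¹ 𝔞⁻¹` (★ `SerreTensorPresentationOfIdeal`) with `𝔭𝔠 = 𝔞`; the roof (r1₀)(r2₀)(r4₀)(rL) and the cover (f1′)(f4); for `λ`: dual pairs, (r3₀)(f3), (DF),
`n = q`, a quasi-inverse of `q̄`; for the level: (r5₀)(f5), `N`-torsion, `𝔞 ⊔ (N) = ⊤`.  OUTPUT: `f : A′.X ≅ A″.X`, `IsMonHom f.hom`, `ι′(a) ≫ f = f ≫ ι″(a)`,
`f ≫ λ″ ≫ f^∨ = λ′`, and `P′ ≫ f = P″` for level points.  HC_CM is proved only modulo the 2 remaining named inputs (hLiu418, h413) until rung 0 closes; this file discharges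
none of them.

## Contents
* §1 **`exists_iso_of_roof_of_cover`** — the `A`-part with the Hecke isogeny `θ : B̄ → A^{(q)}` and its two laws `q̄ ≫ θ = F_q`, `c̄′ = f ≫ c̄ ≫ θ`, the kernel of `c̄ ≫ θ`.
* §2 **`sigma2_assembly`** — adds the λ-leg and the level leg.

## References
* [Liu2021] Y. Liu, Prop. D.8 (3) (p. 135, proof pp. 136–138).
* [Shimura1998] G. Shimura, §13.1 Thm. 1 (pp. 97–99); §18.6 (p. 127).
* [MumfordAV1970] D. Mumford, *Abelian Varieties* (1970), §7 Thm. 4 (p. 72), §15 Thm. 1 (p. 143), §23 (p. 231).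
* [MilneCM2006] J. S. Milne, *Complex Multiplication* (2006), §7 (Def. 7.19, Prop. 7.22, Rem. 7.23).
-/

noncomputable section

universe u

open CategoryTheory CategoryTheory.Limits AlgebraicGeometry MonoidalCategory CartesianMonoidalCategory
open scoped MonObj CategoryTheory.Obj

namespace Literature.AlgebraicGeometry.AbelianSchemes

namespace AbelianSchemeOver

open Literature.AlgebraicGeometry.Motives (frobSpec relFrobeniusOver)
open DualPair

variable {k : Type u} [Field k] [IsAlgClosed k] (p : ℕ) [ExpChar k p] (n : ℕ) {A A' A'' B : AbelianSchemeOver (Spec (.of k))}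
  {O : Type*} [CommRing O] (act : A.RingAction O) (act' : A'.RingAction O) (act'' : A''.RingAction O)
  {m₁ : ℕ} (E₁ : Matrix (Fin m₁) (Fin m₁) O) (hE₁ : E₁ * E₁ = E₁) (P₁ : Matrix (Fin m₁) (Fin 1) O) (Q₁ : Matrix (Fin 1) (Fin m₁) O) {N₁ : ℕ}
  {m₂ : ℕ} (E₂ : Matrix (Fin m₂) (Fin m₂) O) (hE₂ : E₂ * E₂ = E₂) (P₂ : Matrix (Fin m₂) (Fin 1) O) (Q₂ : Matrix (Fin 1) (Fin m₂) O) {N₂ : ℕ}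
  {m₃ : ℕ} (E₃ : Matrix (Fin m₃) (Fin m₃) O) (hE₃ : E₃ * E₃ = E₃) (P₃ : Matrix (Fin m₃) (Fin 1) O) (Q₃ : Matrix (Fin 1) (Fin m₃) O) {N₃ : ℕ}
  (q : A.X ⟶ B.X) [IsMonHom q] [Flat q.left] [Surjective q.left] [QuasiCompact q.left]
  (c : A''.X ⟶ B.X) [IsMonHom c]
  (c' : A'.X ⟶ (A.baseChange (frobSpec k p n)).X) [IsMonHom c']

/-! ## §1 The `A`-part -/

include hE₁ hE₂ hE₃ in
/-- **THE `A`-PART OF HEART-FROB′ (σ2)**: the roof (r1₀)(r2₀)(r4₀)(rL), the cover's kernel clause (f1′) and equivariance (f4), the presentations with `𝔭𝔠 = 𝔞` give an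
`𝒪`-equivariant isomorphism of abelian `k`-schemes `f : A′ ≅ A″` (a homomorphism) and a homomorphism `θ : B̄ → A^{(q)}` with `q̄ ≫ θ = F_q`, `c̄′ = f ≫ c̄ ≫ θ`, and
`Ker(c̄ ≫ θ) ⊆ A″[𝔞]` on all `T`-points. [cite: Liu2021, Prop. D.8 (3) (proof, pp. 136–138)] [cite: Shimura1998, §13.1 Thm. 1 (pp. 97–99)] [cite: MumfordAV1970, §7 Thm. 4 (p. 72)]
[cite: MilneCM2006, §7 (Def. 7.19, Prop. 7.22, Rem. 7.23)] -/
theorem exists_iso_of_roof_of_cover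
    (hN₁ : N₁ ≠ 0) (hP₁ : E₁ * P₁ = P₁) (hQ₁ : Q₁ * E₁ = Q₁)
    (hQP₁ : Q₁ * P₁ = Matrix.scalar (Fin 1) (N₁ : O)) (hPQ₁ : P₁ * Q₁ = Matrix.scalar (Fin m₁) (N₁ : O) * E₁)
    (hN₂ : N₂ ≠ 0) (hP₂ : E₂ * P₂ = P₂) (hQ₂ : Q₂ * E₂ = Q₂)
    (hQP₂ : Q₂ * P₂ = Matrix.scalar (Fin 1) (N₂ : O)) (hPQ₂ : P₂ * Q₂ = Matrix.scalar (Fin m₂) (N₂ : O) * E₂)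
    (hN₃ : N₃ ≠ 0) (hP₃ : E₃ * P₃ = P₃) (hQ₃ : Q₃ * E₃ = Q₃)
    (hQP₃ : Q₃ * P₃ = Matrix.scalar (Fin 1) (N₃ : O)) (hPQ₃ : P₃ * Q₃ = Matrix.scalar (Fin m₃) (N₃ : O) * E₃)
    (𝔠₃ : Set O) (hQ𝔠 : ∀ j k, Q₃ j k ∈ 𝔠₃) (h𝔠₃ : ∀ a ∈ 𝔠₃, ∃ Pa : Matrix (Fin m₃) (Fin 1) O, E₃ * Pa = Pa ∧ Pa * Q₃ = a • E₃)
    {𝔭 𝔠 𝔞 : Ideal O} (h𝔭 : Ideal.span (Set.range fun k => P₁ k 0) = 𝔭) (h𝔠 : Ideal.span (Set.range fun k => P₂ k 0) = 𝔠)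
    (h𝔞 : Ideal.span (Set.range fun k => P₃ k 0) = 𝔞) (hmul : 𝔭 * 𝔠 = 𝔞)
    -- the roof
    (hcker : ∀ ⦃T : Over (Spec (.of k))⦄ (t : T ⟶ A''.X), t ≫ c = 1 ↔ ∀ a ∈ 𝔭, t ≫ act''.i a = 1)
    (hcsurj : Function.Surjective c.left.base)
    (hequiv : ∀ a : O, ∃ b : B.X ⟶ B.X, act.i a ≫ q = q ≫ b ∧ act''.i a ≫ c = c ≫ b)
    (hker : ∀ ⦃T : Over (Spec (.of k))⦄ (t : T ⟶ A.X),
      t ≫ relFrobeniusOver p n A.X = (1 : T ⟶ (A.baseChange (frobSpec k p n)).X) ↔ ∀ a ∈ 𝔠, t ≫ act.i a ≫ q = 1)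
    -- the cover
    (hc'ker : ∀ ⦃T : Over (Spec (.of k))⦄ (t : T ⟶ A'.X),
      t ≫ c' = (1 : T ⟶ (A.baseChange (frobSpec k p n)).X) ↔ ∀ a ∈ 𝔞, t ≫ act'.i a = 1)
    (hc'surj : Function.Surjective c'.left.base)
    (hf4 : ∀ a : O, act'.i a ≫ c' = c' ≫ (act.baseChange (frobSpec k p n)).i a) :
    ∃ (f : A'.X ≅ A''.X) (θ : B.X ⟶ (A.baseChange (frobSpec k p n)).X), IsMonHom f.hom ∧ IsMonHom θ ∧
      (∀ a, act'.i a ≫ f.hom = f.hom ≫ act''.i a) ∧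
      q ≫ θ = relFrobeniusOver p n A.X ∧ c' = f.hom ≫ c ≫ θ ∧
      ∀ ⦃T : Over (Spec (.of k))⦄ (d : T ⟶ A''.X), d ≫ (c ≫ θ) = 1 → ∀ a ∈ 𝔞, d ≫ act''.i a = 1 := by
  haveI : IsCommMonObj A'.X := isCommMonObj_of_field A'
  haveI : IsCommMonObj A''.X := isCommMonObj_of_field A''
  haveI : IsCommMonObj (serreTensor act'' E₁ hE₁).X := isCommMonObj_of_field _
  haveI : Surjective c'.left := ⟨hc'surj⟩
  haveI : Surjective c.left := ⟨hcsurj⟩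
  -- roof leg
  obtain ⟨e₁, e', χ, he₁, he₁mon, -, he'mon, he'eq, hχmon, -, hχψ, hF⟩ :=
    exists_iso_frobeniusTwist_serreTensor_of_roof_over p n act act'' E₁ hE₁ P₁ Q₁ E₂ hE₂ P₂ Q₂ E₃ hE₃ P₃ Q₃ q c
      hN₁ hP₁ hQ₁ hQP₁ hPQ₁ hN₂ hP₂ hQ₂ hQP₂ hPQ₂ hN₃ hP₃ hQ₃ hQP₃ hPQ₃ h𝔭 h𝔠 h𝔞 hmul hcker hequiv hker
  haveI := he₁mon
  haveI := he'mon
  haveI := hχmon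
  -- cover leg
  obtain ⟨e₄, he₄, he₄mon, -⟩ :=
    exists_iso_serreTranslate_comp_eq_of_comp_eq_one_iff_forall_mem act' E₃ hE₃ P₃ Q₃ c' hN₃ hP₃ hQ₃ hQP₃ hPQ₃ h𝔞 hc'ker
  haveI := he₄mon
  have he₄eq : ∀ a, (serreAction act' E₃ hE₃).i a ≫ e₄.hom = e₄.hom ≫ (act.baseChange (frobSpec k p n)).i a := fun a =>
    serreAction_comp_eq_comp_of_comp_eq act' E₃ hE₃ P₃ Q₃ c' hN₃ hP₃ hQ₃ hQP₃ hPQ₃ e₄.hom he₄ a _ (hf4 a)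
  -- untwist `g := e₄ ≪≫ e′`
  have hg : ∀ a, (serreAction act' E₃ hE₃).i a ≫ (e₄ ≪≫ e').hom = (e₄ ≪≫ e').hom ≫ (serreAction act'' E₃ hE₃).i a := fun a => by
    rw [Iso.trans_hom, ← Category.assoc, he₄eq a, Category.assoc, he'eq a, Category.assoc]
  haveI : IsMonHom (e₄ ≪≫ e').hom := by rw [Iso.trans_hom]; infer_instance
  obtain ⟨f, hfmon, hfequiv, hfcov, -⟩ :=
    exists_iso_of_equivariant_serreTensor_iso act' act'' E₃ hE₃ P₃ Q₃ hN₃ hP₃ hQ₃ hQP₃ hPQ₃ 𝔠₃ hQ𝔠 h𝔠₃ (e₄ ≪≫ e') hg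
  haveI := hfmon
  have hftr := serreTranslate_comp_eq_comp_serreTranslate_of_cover act' act'' E₃ hE₃ P₃ Q₃ hN₃ hP₃ hQ₃ hQP₃ hPQ₃ (e₄ ≪≫ e').hom f.hom hfcov
  -- the Hecke isogeny `θ := e₁⁻¹ ≫ χ ≫ e′⁻¹`
  refine ⟨f, e₁.inv ≫ χ ≫ e'.inv, hfmon, inferInstance, hfequiv, ?_, ?_, ?_⟩
  · -- `q̄ ≫ θ = F_q`
    calc q ≫ e₁.inv ≫ χ ≫ e'.inv = (q ≫ e₁.inv ≫ χ) ≫ e'.inv := by simp only [Category.assoc]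
      _ = (relFrobeniusOver p n A.X ≫ e'.hom) ≫ e'.inv := by rw [← hF]
      _ = relFrobeniusOver p n A.X := (Iso.comp_inv_eq e').2 rfl
  · -- `c̄′ = f ≫ c̄ ≫ θ`
    have h1 : c ≫ e₁.inv = serreTranslate act'' E₁ hE₁ P₁ := by rw [← he₁, Category.assoc, e₁.hom_inv_id, Category.comp_id]
    haveI := isMonHom_serreTranslate act' E₃ hE₃ P₃
    calc c' = (serreTranslate act' E₃ hE₃ P₃ ≫ (e₄ ≪≫ e').hom) ≫ e'.inv := by
            rw [Iso.trans_hom, ← Category.assoc, he₄, Category.assoc, e'.hom_inv_id, Category.comp_id]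
      _ = (f.hom ≫ serreTranslate act'' E₃ hE₃ P₃) ≫ e'.inv := by rw [hftr]
      _ = f.hom ≫ c ≫ e₁.inv ≫ χ ≫ e'.inv := by rw [← Category.assoc c, h1, ← Category.assoc (serreTranslate act'' E₁ hE₁ P₁), hχψ]; simp only [Category.assoc]
  · -- the kernel of `c̄ ≫ θ = ψ″_𝔞 ≫ e′⁻¹` is `𝔞`-torsion
    intro T d hd
    have h1 : c ≫ e₁.inv = serreTranslate act'' E₁ hE₁ P₁ := by rw [← he₁, Category.assoc, e₁.hom_inv_id, Category.comp_id]
    have hd' : d ≫ serreTranslate act'' E₃ hE₃ P₃ = 1 := by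
      rw [← Category.assoc c, h1, ← Category.assoc (serreTranslate act'' E₁ hE₁ P₁), hχψ, ← Category.assoc, comp_iso_inv_eq_one_iff] at hd
      exact hd
    exact (comp_serreTranslate_eq_one_iff_forall_mem act'' E₃ hE₃ P₃ hP₃ h𝔞 d).1 hd'


/-! ## §2 The full σ2 assembly: `A`-part + λ-leg + level leg -/

include hE₁ hE₂ hE₃ in
/-- **σ2 ASSEMBLY FOR HEART-FROB′.**  Under the hypotheses of `exists_iso_of_roof_of_cover` plus, for the polarisations: normalised dual pairs on `A A′ A″ B̄ A^{(q)}`,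
homomorphisms `λ λ′ λ″ λ_B λ^{(q)}`, the roof laws (r3₀) `q̄^*λ_B = p·λ`, `c̄^*λ_B = p·λ″`, the cover law (f3) `c̄′^*λ^{(q)} = n·λ′`, ★ (DF) `F_q^*λ^{(q)} = q·λ`, `n = q`,
a quasi-inverse `r ≫ q̄ = [M]` — the isomorphism `f : A′ ≅ A″` is `𝒪`-equivariant, EXACT on `λ` (`f ≫ λ″ ≫ f^∨ = λ′`), and matches the level-`N` points whenever
`𝔞 ⊔ (N) = ⊤` ((f6)): from (r5₀) `P ≫ q̄ = P″ ≫ c̄` and (f5) `P′ ≫ c̄′ = P ≫ F_q` one gets `P′ ≫ f = P″`.  The closer of `stub_HFROB` instantiates this at the moduli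
datum's `Roof₀`/`FrobCover₀` and applies the transfer brick + `inj₀`. [cite: Liu2021, Prop. D.8 (3) (p. 135, proof pp. 136–138)] [cite: Shimura1998, §13.1 Thm. 1 (pp. 97–99); §18.6 (p. 127)]
[cite: MumfordAV1970, §7 Thm. 4 (p. 72), §15 Thm. 1 (p. 143), §23 (p. 231)] [cite: MilneCM2006, §7 (Def. 7.19, Prop. 7.22, Rem. 7.23)] -/
theorem sigma2_assembly
    (hN₁ : N₁ ≠ 0) (hP₁ : E₁ * P₁ = P₁) (hQ₁ : Q₁ * E₁ = Q₁)
    (hQP₁ : Q₁ * P₁ = Matrix.scalar (Fin 1) (N₁ : O)) (hPQ₁ : P₁ * Q₁ = Matrix.scalar (Fin m₁) (N₁ : O) * E₁)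
    (hN₂ : N₂ ≠ 0) (hP₂ : E₂ * P₂ = P₂) (hQ₂ : Q₂ * E₂ = Q₂)
    (hQP₂ : Q₂ * P₂ = Matrix.scalar (Fin 1) (N₂ : O)) (hPQ₂ : P₂ * Q₂ = Matrix.scalar (Fin m₂) (N₂ : O) * E₂)
    (hN₃ : N₃ ≠ 0) (hP₃ : E₃ * P₃ = P₃) (hQ₃ : Q₃ * E₃ = Q₃)
    (hQP₃ : Q₃ * P₃ = Matrix.scalar (Fin 1) (N₃ : O)) (hPQ₃ : P₃ * Q₃ = Matrix.scalar (Fin m₃) (N₃ : O) * E₃)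
    (𝔠₃ : Set O) (hQ𝔠 : ∀ j k, Q₃ j k ∈ 𝔠₃) (h𝔠₃ : ∀ a ∈ 𝔠₃, ∃ Pa : Matrix (Fin m₃) (Fin 1) O, E₃ * Pa = Pa ∧ Pa * Q₃ = a • E₃)
    {𝔭 𝔠 𝔞 : Ideal O} (h𝔭 : Ideal.span (Set.range fun k => P₁ k 0) = 𝔭) (h𝔠 : Ideal.span (Set.range fun k => P₂ k 0) = 𝔠)
    (h𝔞 : Ideal.span (Set.range fun k => P₃ k 0) = 𝔞) (hmul : 𝔭 * 𝔠 = 𝔞)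
    (hcker : ∀ ⦃T : Over (Spec (.of k))⦄ (t : T ⟶ A''.X), t ≫ c = 1 ↔ ∀ a ∈ 𝔭, t ≫ act''.i a = 1)
    (hcsurj : Function.Surjective c.left.base)
    (hequiv : ∀ a : O, ∃ b : B.X ⟶ B.X, act.i a ≫ q = q ≫ b ∧ act''.i a ≫ c = c ≫ b)
    (hker : ∀ ⦃T : Over (Spec (.of k))⦄ (t : T ⟶ A.X),
      t ≫ relFrobeniusOver p n A.X = (1 : T ⟶ (A.baseChange (frobSpec k p n)).X) ↔ ∀ a ∈ 𝔠, t ≫ act.i a ≫ q = 1)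
    (hc'ker : ∀ ⦃T : Over (Spec (.of k))⦄ (t : T ⟶ A'.X),
      t ≫ c' = (1 : T ⟶ (A.baseChange (frobSpec k p n)).X) ↔ ∀ a ∈ 𝔞, t ≫ act'.i a = 1)
    (hc'surj : Function.Surjective c'.left.base)
    (hf4 : ∀ a : O, act'.i a ≫ c' = c' ≫ (act.baseChange (frobSpec k p n)).i a)
    -- polarisation data
    (D : A.DualPair) (D' : A'.DualPair) (D'' : A''.DualPair) (DB : B.DualPair) (Dq : (A.baseChange (frobSpec k p n)).DualPair)
    (hD : Nonempty ((Scheme.Modules.pullback (unitHatSlice D)).obj D.P ≅ SheafOfModules.unit _))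
    (hD' : Nonempty ((Scheme.Modules.pullback (unitHatSlice D')).obj D'.P ≅ SheafOfModules.unit _))
    (hD'' : Nonempty ((Scheme.Modules.pullback (unitHatSlice D'')).obj D''.P ≅ SheafOfModules.unit _))
    (hDB : Nonempty ((Scheme.Modules.pullback (unitHatSlice DB)).obj DB.P ≅ SheafOfModules.unit _))
    (hDq : Nonempty ((Scheme.Modules.pullback (unitHatSlice Dq)).obj Dq.P ≅ SheafOfModules.unit _))
    (lam : A.X ⟶ D.hat.X) (lam' : A'.X ⟶ D'.hat.X) (lam'' : A''.X ⟶ D''.hat.X) (lamB : B.X ⟶ DB.hat.X) (lamq : (A.baseChange (frobSpec k p n)).X ⟶ Dq.hat.X)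
    [IsMonHom lam'] [IsMonHom lam''] [IsMonHom lamB] [IsMonHom lamq]
    -- the relative Frobenius as a HOMOMORPHISM `A.X ⟶ (A.baseChange (frobSpec k p n)).X` (pen: `F := relFrobeniusOver p n A.X`, `rfl`, ★ `isMonHom_relFrobeniusOver`)
    (F : A.X ⟶ (A.baseChange (frobSpec k p n)).X) [IsMonHom F] (hFdef : F = relFrobeniusOver p n A.X)
    -- a «Verschiebung» for `F`: any homomorphism `V` with `F ≫ V = [M]_A`, `M ≠ 0` (pen: ★ `existsUnique_relFrobenius_comp_eq_pow_zsmul_id`, `M = q`)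
    (V : (A.baseChange (frobSpec k p n)).X ⟶ A.X) [IsMonHom V] {M pp nn qq : ℕ} (hM : M ≠ 0) (hpp : pp ≠ 0) (hqq : qq ≠ 0) (hn : nn = qq)
    (hV : F ≫ V = (𝟙 A.X) ^ M)
    (hr3q : q ≫ lamB ≫ dualIsogenyOver q D DB = lam ≫ D.hat.mulN pp)
    (hr3c : c ≫ lamB ≫ dualIsogenyOver c D'' DB = lam'' ≫ D''.hat.mulN pp)
    (hf3 : c' ≫ lamq ≫ dualIsogenyOver c' D' Dq = lam' ≫ D'.hat.mulN nn)
    (hDF : F ≫ lamq ≫ dualIsogenyOver F D Dq = lam ≫ D.hat.mulN qq) :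
    ∃ (f : A'.X ≅ A''.X) (_ : IsMonHom f.hom), (∀ a, act'.i a ≫ f.hom = f.hom ≫ act''.i a) ∧
      f.hom ≫ lam'' ≫ dualIsogenyOver f.hom D' D'' = lam' ∧
      ∀ {N : ℕ}, 𝔞 ⊔ Ideal.span {(N : O)} = ⊤ → ∀ ⦃T : Over (Spec (.of k))⦄ (P : T ⟶ A.X) (P' : T ⟶ A'.X) (P'' : T ⟶ A''.X),
        P' ^ N = 1 → P'' ^ N = 1 → P ≫ q = P'' ≫ c → P' ≫ c' = P ≫ F → P' ≫ f.hom = P'' := by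
  obtain ⟨f, θ, hfmon, hθmon, hfequiv, hθ, hc', hkerθ⟩ :=
    exists_iso_of_roof_of_cover p n act act' act'' E₁ hE₁ P₁ Q₁ E₂ hE₂ P₂ Q₂ E₃ hE₃ P₃ Q₃ q c c' hN₁ hP₁ hQ₁ hQP₁ hPQ₁ hN₂ hP₂ hQ₂ hQP₂ hPQ₂
      hN₃ hP₃ hQ₃ hQP₃ hPQ₃ 𝔠₃ hQ𝔠 h𝔠₃ h𝔭 h𝔠 h𝔞 hmul hcker hcsurj hequiv hker hc'ker hc'surj hf4
  haveI := hfmon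
  haveI := hθmon
  haveI : IsCommMonObj A''.X := isCommMonObj_of_field A''
  have hθF : q ≫ θ = F := hθ.trans hFdef.symm
  -- the quasi-inverse `r := θ ≫ V` of `q̄`: `q̄ ≫ (θ ≫ V ≫ q̄) = F ≫ V ≫ q̄ = [M] ≫ q̄ = q̄ ≫ [M]`, cancel the fppf epimorphism `q̄`
  have hr : (θ ≫ V) ≫ q = (𝟙 B.X) ^ M := by
    haveI : Epi q.left := Flat.epi_of_flat_of_surjective _
    haveI : Epi q := Over.epi_of_epi_left _
    rw [← cancel_epi q]
    calc q ≫ (θ ≫ V) ≫ q = ((q ≫ θ) ≫ V) ≫ q := by simp only [Category.assoc]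
      _ = ((𝟙 A.X) ^ M) ≫ q := by rw [hθF, hV]
      _ = q ≫ ((𝟙 B.X) ^ M) := by rw [MonObj.pow_comp, MonObj.comp_pow, Category.id_comp, Category.comp_id]
  refine ⟨f, hfmon, hfequiv, ?_, fun {N} hcop T P P' P'' hP' hP'' hr5 hf5 => ?_⟩
  · -- λ-leg: transport (f3) and (DF) along `c̄′ = f ≫ c̄ ≫ θ`, `F_q = q̄ ≫ θ`, then ★ `lam_transport_of_roof_of_cover`
    have hf3' : (f.hom ≫ c ≫ θ) ≫ lamq ≫ dualIsogenyOver (f.hom ≫ c ≫ θ) D' Dq = lam' ≫ D'.hat.mulN nn := by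
      rw [dualIsogenyOver_congr D' Dq hc'.symm, ← hc']; exact hf3
    have hDF' : (q ≫ θ) ≫ lamq ≫ dualIsogenyOver (q ≫ θ) D Dq = lam ≫ D.hat.mulN qq := by
      rw [dualIsogenyOver_congr D Dq hθF, hθF]; exact hDF
    exact lam_transport_of_roof_of_cover D D' D'' DB Dq hD hD' hD'' hDB hDq lam lam' lam'' lamB lamq q c θ f.hom (θ ≫ V) hM hpp hqq hn hr hr3q hr3c hf3' hDF'
  · -- level leg
    exact level_transport_of_roof_of_cover q c c' F θ f.hom act'' hθF hc' hcop (fun d hd => hkerθ d hd) P P' P'' hP' hP'' hr5 hf5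

/-! ## §3 The consumer-facing form: polarisations, the twist `λ^{(q)}`, the Verschiebung and ★ (DF) discharged -/

omit [Flat q.left] [Surjective q.left] [QuasiCompact q.left] in
include hE₁ hE₂ hE₃ in
/-- **σ2 ASSEMBLY FOR HEART-FROB′ — THE FORM THE CLOSER OF `stub_HFROB` INSTANTIATES** (every hypothesis in the token shape of a `Roof₀` ∕ `FrobCover₀` conjunct or of a
`ModuliDatum` field, at `A := sch₀Of … x̄`, `act := (ρ.baseChange ι_s).baseChange x̄.left`, `D := dual₀Of … x̄`, `pol := pol₀Of … x̄`, `p := pChar`, `n := fDeg`): `k = k̄` of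
characteristic `p` (prime), polarisations `pol pol′ pol″` of `A A′ A″` (their unit hypotheses are ★ `Polarization.nonempty_unitHatSlice_iso`), the roof `(B̄, DB, λ_B, q̄, c̄)` with
(r1₀) `Flat q̄.left ∧ Surjective`, (r2₀), (r3₀) with scalar `pp ≠ 0`, (r4₀), (rL); the cover `c̄′` with (f1′), (f3) against `(pol.baseChange (frobSpec k p n)).lam` with scalar `nn = p ^ n`
(the datum's `twistNorm_eq`), (f4).  DISCHARGED HERE: the Verschiebung `V` with `F_q ≫ V = [q]` (★ `existsUnique_relFrobenius_comp_eq_pow_zsmul_id`), ★ (DF)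
`F_q ≫ λ^{(q)} ≫ F_q^∨ = λ ≫ [q]` (`relFrobeniusHom_comp_baseChangeHom_comp_dualIsogenyOver`), `QuasiCompact q̄.left` (★ `quasiCompact_hom_left`), `IsMonHom F_q`
(★ `isMonHom_relFrobeniusOver`).  OUTPUT: the four clauses of σ1's skeleton — `f : A′.X ≅ A″.X`, `IsMonHom f.hom`, `ι′(a) ≫ f = f ≫ ι″(a)`, `f ≫ λ″ ≫ f^∨ = λ′`, and the
level clause `P′ ≫ f = P″` from (r5₀) `P ≫ q̄ = P″ ≫ c̄`, (f5) `P′ ≫ c̄′ = P ≫ F_q`, `N`-torsion and (f6) `𝔞 ⊔ (N) = ⊤`. [cite: Liu2021, Prop. D.8 (3) (p. 135, proof pp. 136–138)]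
[cite: Shimura1998, §13.1 Thm. 1 (pp. 97–99); §18.6 (p. 127)] [cite: MumfordAV1970, §7 Thm. 4 (p. 72), §15 Thm. 1 (p. 143), §23 (p. 231)] [cite: MilneCM2006, §7 (Prop. 7.22, Rem. 7.23)] -/
theorem sigma2_assembly_of_polarizations [CharP k p] (hp : p.Prime)
    (hN₁ : N₁ ≠ 0) (hP₁ : E₁ * P₁ = P₁) (hQ₁ : Q₁ * E₁ = Q₁)
    (hQP₁ : Q₁ * P₁ = Matrix.scalar (Fin 1) (N₁ : O)) (hPQ₁ : P₁ * Q₁ = Matrix.scalar (Fin m₁) (N₁ : O) * E₁)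
    (hN₂ : N₂ ≠ 0) (hP₂ : E₂ * P₂ = P₂) (hQ₂ : Q₂ * E₂ = Q₂)
    (hQP₂ : Q₂ * P₂ = Matrix.scalar (Fin 1) (N₂ : O)) (hPQ₂ : P₂ * Q₂ = Matrix.scalar (Fin m₂) (N₂ : O) * E₂)
    (hN₃ : N₃ ≠ 0) (hP₃ : E₃ * P₃ = P₃) (hQ₃ : Q₃ * E₃ = Q₃)
    (hQP₃ : Q₃ * P₃ = Matrix.scalar (Fin 1) (N₃ : O)) (hPQ₃ : P₃ * Q₃ = Matrix.scalar (Fin m₃) (N₃ : O) * E₃)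
    (𝔠₃ : Set O) (hQ𝔠 : ∀ j k, Q₃ j k ∈ 𝔠₃) (h𝔠₃ : ∀ a ∈ 𝔠₃, ∃ Pa : Matrix (Fin m₃) (Fin 1) O, E₃ * Pa = Pa ∧ Pa * Q₃ = a • E₃)
    {𝔭 𝔠 𝔞 : Ideal O} (h𝔭 : Ideal.span (Set.range fun k => P₁ k 0) = 𝔭) (h𝔠 : Ideal.span (Set.range fun k => P₂ k 0) = 𝔠)
    (h𝔞 : Ideal.span (Set.range fun k => P₃ k 0) = 𝔞) (hmul : 𝔭 * 𝔠 = 𝔞)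
    -- polarisations of `A A′ A″`; the roof's `B̄` with its dual pair and `λ_B`
    {D : A.DualPair} {D' : A'.DualPair} {D'' : A''.DualPair} (pol : A.Polarization D) (pol' : A'.Polarization D') (pol'' : A''.Polarization D'')
    (DB : B.DualPair) (lamB : B.X ⟶ DB.hat.X) [IsMonHom lamB]
    (hDB : Nonempty ((Scheme.Modules.pullback (unitHatSlice DB)).obj DB.P ≅ SheafOfModules.unit _))
    -- the roof (r1₀)(r2₀)(r3₀)(r4₀)(rL)
    (hqflat : Flat q.left) (hqsurj : Function.Surjective q.left.base)
    (hcker : ∀ ⦃T : Over (Spec (.of k))⦄ (t : T ⟶ A''.X), t ≫ c = 1 ↔ ∀ a ∈ 𝔭, t ≫ act''.i a = 1)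
    (hcsurj : Function.Surjective c.left.base) {pp : ℕ} (hpp : pp ≠ 0)
    (hr3q : q ≫ lamB ≫ dualIsogenyOver q D DB = pol.lam ≫ D.hat.mulN pp)
    (hr3c : c ≫ lamB ≫ dualIsogenyOver c D'' DB = pol''.lam ≫ D''.hat.mulN pp)
    (hequiv : ∀ a : O, ∃ b : B.X ⟶ B.X, act.i a ≫ q = q ≫ b ∧ act''.i a ≫ c = c ≫ b)
    (hker : ∀ ⦃T : Over (Spec (.of k))⦄ (t : T ⟶ A.X),
      t ≫ relFrobeniusOver p n A.X = (1 : T ⟶ (A.baseChange (frobSpec k p n)).X) ↔ ∀ a ∈ 𝔠, t ≫ act.i a ≫ q = 1)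
    -- the cover (f1′)(f3)(f4), `n_γ = q`
    (hc'ker : ∀ ⦃T : Over (Spec (.of k))⦄ (t : T ⟶ A'.X),
      t ≫ c' = (1 : T ⟶ (A.baseChange (frobSpec k p n)).X) ↔ ∀ a ∈ 𝔞, t ≫ act'.i a = 1)
    (hc'surj : Function.Surjective c'.left.base) {nn : ℕ}
    (hf3 : c' ≫ (pol.baseChange (frobSpec k p n)).lam ≫ dualIsogenyOver c' D' (D.baseChange (frobSpec k p n)) = pol'.lam ≫ D'.hat.mulN nn)
    (hn : nn = p ^ n)
    (hf4 : ∀ a : O, act'.i a ≫ c' = c' ≫ (act.baseChange (frobSpec k p n)).i a) :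
    ∃ (f : A'.X ≅ A''.X) (_ : IsMonHom f.hom), (∀ a, act'.i a ≫ f.hom = f.hom ≫ act''.i a) ∧
      f.hom ≫ pol''.lam ≫ dualIsogenyOver f.hom D' D'' = pol'.lam ∧
      ∀ {N : ℕ}, 𝔞 ⊔ Ideal.span {(N : O)} = ⊤ → ∀ ⦃T : Over (Spec (.of k))⦄ (P : T ⟶ A.X) (P' : T ⟶ A'.X) (P'' : T ⟶ A''.X),
        P' ^ N = 1 → P'' ^ N = 1 → P ≫ q = P'' ≫ c → P' ≫ c' = P ≫ relFrobeniusOver p n A.X → P' ≫ f.hom = P'' := by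
  -- instances: the roof leg `q̄` is flat, surjective, quasi-compact; the polarisations are homomorphisms; `F_q` is a homomorphism
  haveI := hqflat
  haveI : Surjective q.left := ⟨hqsurj⟩
  haveI : QuasiCompact q.left := quasiCompact_hom_left q
  haveI := pol.isMonHom
  haveI := pol'.isMonHom
  haveI := pol''.isMonHom
  haveI := (pol.baseChange (frobSpec k p n)).isMonHom
  -- (typed against the group structure of `A.baseChange (frobSpec k p n)`, which is `Functor.grpObjObj` only up to unfolding)
  haveI hFmon : @IsMonHom _ _ _ A.X (A.baseChange (frobSpec k p n)).X _ _ (relFrobeniusOver p n A.X) :=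
    Literature.AlgebraicGeometry.Motives.isMonHom_relFrobeniusOver p n A.X
  haveI := Fact.mk hp
  -- the unit hypotheses of the dual pairs carrying polarisations
  have hD := pol.nonempty_unitHatSlice_iso
  have hD' := pol'.nonempty_unitHatSlice_iso
  have hD'' := pol''.nonempty_unitHatSlice_iso
  have hDq := (pol.baseChange (frobSpec k p n)).nonempty_unitHatSlice_iso
  -- the Verschiebung: `F_q ≫ V = [q]_A`
  obtain ⟨V, hV, -⟩ :=
    Literature.AlgebraicGeometry.Motives.AbelianVariety.existsUnique_relFrobenius_comp_eq_pow_zsmul_id p A.toAffine.toAbelianVariety n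
  let V' : (A.baseChange (frobSpec k p n)).X ⟶ A.X := V.hom.hom.hom
  haveI hVmon : @IsMonHom _ _ _ (A.baseChange (frobSpec k p n)).X A.X _ _ V' := inferInstanceAs (IsMonHom V.hom.hom.hom)
  have hV' : @CategoryStruct.comp _ _ A.X (A.baseChange (frobSpec k p n)).X A.X (relFrobeniusOver p n A.X) V' = (𝟙 A.X) ^ (p ^ n) := by
    have h : (A.toAffine.toAbelianVariety.relFrobenius p n ≫ V).hom.hom.hom = ((((p ^ n : ℕ) : ℤ) • 𝟙 A.toAffine.toAbelianVariety).hom.hom.hom) :=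
      congrArg (fun φ => φ.hom.hom.hom) hV
    rw [Literature.AlgebraicGeometry.Motives.AbelianVariety.hom_natCast_zsmul_id] at h
    exact h
  -- ★ (DF): `F_q ≫ λ^{(q)} ≫ F_q^∨ = λ ≫ [q]`
  have hDF : @CategoryStruct.comp _ _ A.X (A.baseChange (frobSpec k p n)).X _ (relFrobeniusOver p n A.X)
      ((pol.baseChange (frobSpec k p n)).lam ≫
        dualIsogenyOver (A' := A) (B := A.baseChange (frobSpec k p n)) (relFrobeniusOver p n A.X) D (D.baseChange (frobSpec k p n))) =
        pol.lam ≫ D.hat.mulN (p ^ n) := by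
    haveI : IsMonHom (relFrobeniusHom p n A.toAffine.toAbelianVariety) := isMonHom_relFrobeniusHom p n _
    exact relFrobeniusHom_comp_baseChangeHom_comp_dualIsogenyOver p n A.toAffine.toAbelianVariety D hD pol.lam
  exact sigma2_assembly p n act act' act'' E₁ hE₁ P₁ Q₁ E₂ hE₂ P₂ Q₂ E₃ hE₃ P₃ Q₃ q c c' hN₁ hP₁ hQ₁ hQP₁ hPQ₁ hN₂ hP₂ hQ₂ hQP₂ hPQ₂
    hN₃ hP₃ hQ₃ hQP₃ hPQ₃ 𝔠₃ hQ𝔠 h𝔠₃ h𝔭 h𝔠 h𝔞 hmul hcker hcsurj hequiv hker hc'ker hc'surj hf4 D D' D'' DB (D.baseChange (frobSpec k p n))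
    hD hD' hD'' hDB hDq pol.lam pol'.lam pol''.lam lamB (pol.baseChange (frobSpec k p n)).lam
    (relFrobeniusOver p n A.X) rfl V' (pow_ne_zero n hp.ne_zero) hpp (pow_ne_zero n hp.ne_zero) hn hV' hr3q hr3c hf3 hDF

end AbelianSchemeOver

end Literature.AlgebraicGeometry.AbelianSchemes

end
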